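import Literature.AlgebraicGeometry.Modules.StalkExactCoherent
import Literature.AlgebraicGeometry.Modules.LocalExactness
import Mathlib.Topology.Sheaves.LocallySurjective
import Mathlib.Topology.Sheaves.Abelian
import HarnessLib

/-!
# Stalkwise criteria for `𝒪_X`-modules: epimorphisms, isomorphisms, vanishing and exactness are detected on stalks

Layer `Literature/AlgebraicGeometry/Modules` (0 definitions, 0 named facts, no instances, no notation). Hartshorne II
Prop. 1.1 ("a morphism of sheaves is an isomorphism if and only if the induced map on the stalk is an isomorphism for
every point") and II Ex. 1.2 (surjectivity and exactness are stalk-local), for the tree's stalk functor of `𝒪_X`-modules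
`Modules/SkyscraperModule.stalkFunctor x : X.Modules ⥤ ModuleCat 𝒪_{X,x}`; the tree already has the monomorphism
criterion (`Modules/PullbackStalk.mono_of_stalkFunctor_map_injective`), the short-exactness of stalks
(`Modules/StalkExactCoherent.shortExact_map_stalkFunctor`) and a local exactness test by sections
(`Modules/LocalExactness.exact_of_locally_exact`). Here, as standalone lemmas (the isomorphism argument is currently
only INLINE in `Modules/PullbackReflectsIsoOfFlatSurjective.isIso_of_isIso_pullback_map`, which stays unchanged):

* `epi_of_stalkFunctor_map_surjective`, `stalkFunctor_map_surjective_iff_epi` (Mathlib: locally surjective ⇔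
  surjective on stalks ⇔ epi for the underlying abelian sheaves; the forgetful `modulesToSheaf X` is faithful);
* **`isIso_of_stalkFunctor_map_bijective`**, `stalkFunctor_map_bijective_of_isIso`, `isIso_iff_stalkFunctor_map_bijective`;
* `isZero_stalk_of_isZero`, **`isZero_of_forall_isZero_stalk`**, `isZero_iff_forall_isZero_stalk`;
* **`exact_iff_forall_stalk_exact`** for short complexes of `𝒪_X`-modules.

## References

* R. Hartshorne, *Algebraic Geometry*, GTM 52 (1977), II Prop. 1.1 (p. 63), II Ex. 1.2 (p. 66). [Hartshorne1977]
* U. Görtz, T. Wedhorn, *Algebraic Geometry I*, 2nd ed. (2020), (7.8.6), Prop. 2.23. [GortzWedhorn2020]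
-/

noncomputable section

-- `TopCat.Presheaf`/`Scheme.Modules` are not reducible (as in Mathlib's `AlgebraicGeometry/Modules`).
set_option backward.isDefEq.respectTransparency false

universe u

open CategoryTheory CategoryTheory.Limits AlgebraicGeometry TopologicalSpace Opposite

namespace Literature.AlgebraicGeometry.Modules

open Literature.AlgebraicGeometry.HodgeTheory Literature.AlgebraicGeometry.Motives

variable {X : Scheme.{u}}

/-! ## Epimorphisms -/

/-- **A morphism of `𝒪_X`-modules whose stalk maps are all surjective is an epimorphism** (surjective on stalks ⇒
locally surjective ⇒ epi as a morphism of abelian sheaves ⇒ epi, the forgetful functor being faithful).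
[cite: Hartshorne1977, II Ex. 1.2 (b) (p. 66)] -/
theorem epi_of_stalkFunctor_map_surjective {M N : X.Modules} (φ : M ⟶ N)
    (h : ∀ x : X, Function.Surjective ((stalkFunctor x).map φ)) : Epi φ := by
  have hloc : TopCat.Presheaf.IsLocallySurjective φ.mapPresheaf :=
    (TopCat.Presheaf.locally_surjective_iff_surjective_on_stalks φ.mapPresheaf).mpr fun x => h x
  have hepi : Epi ((modulesToSheaf X).map φ) :=
    (TopCat.Sheaf.isLocallySurjective_iff_epi ((modulesToSheaf X).map φ)).mp hloc
  exact (modulesToSheaf X).epi_of_epi_map hepi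

/-- The stalk maps of `φ` are all surjective iff `φ` is an epimorphism. [cite: Hartshorne1977, II Ex. 1.2 (b) (p. 66)] -/
theorem stalkFunctor_map_surjective_iff_epi {M N : X.Modules} (φ : M ⟶ N) :
    (∀ x : X, Function.Surjective ((stalkFunctor x).map φ)) ↔ Epi φ :=
  ⟨epi_of_stalkFunctor_map_surjective φ, fun _ x => stalkFunctor_map_surjective_of_epi x φ⟩

/-! ## Isomorphisms -/

/-- **Hartshorne II Prop. 1.1: a morphism of `𝒪_X`-modules whose stalk maps are all bijective is an isomorphism**
(mono and epi in the abelian category `X.Modules`). [cite: Hartshorne1977, II Prop. 1.1 (p. 63)] -/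
theorem isIso_of_stalkFunctor_map_bijective {M N : X.Modules} (φ : M ⟶ N)
    (h : ∀ x : X, Function.Bijective ((stalkFunctor x).map φ)) : IsIso φ := by
  haveI : Mono φ := mono_of_stalkFunctor_map_injective φ fun x => (h x).1
  haveI : Epi φ := epi_of_stalkFunctor_map_surjective φ fun x => (h x).2
  exact isIso_of_mono_of_epi φ

/-- The stalk maps of an isomorphism are bijective. [cite: Hartshorne1977, II Prop. 1.1 (p. 63)] -/
theorem stalkFunctor_map_bijective_of_isIso {M N : X.Modules} (φ : M ⟶ N) [IsIso φ] (x : X) :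
    Function.Bijective ((stalkFunctor x).map φ) :=
  ((stalkFunctor x).mapIso (asIso φ)).toLinearEquiv.bijective

/-- **A morphism of `𝒪_X`-modules is an isomorphism iff all its stalk maps are bijective.**
[cite: Hartshorne1977, II Prop. 1.1 (p. 63)] -/
theorem isIso_iff_stalkFunctor_map_bijective {M N : X.Modules} (φ : M ⟶ N) :
    IsIso φ ↔ ∀ x : X, Function.Bijective ((stalkFunctor x).map φ) :=
  ⟨fun _ x => stalkFunctor_map_bijective_of_isIso φ x, isIso_of_stalkFunctor_map_bijective φ⟩

/-! ## Vanishing -/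

/-- The stalks of a zero module vanish. [cite: GortzWedhorn2020, (7.8.6)] -/
theorem isZero_stalk_of_isZero {M : X.Modules} (hM : IsZero M) (x : X) : IsZero ((stalkFunctor x).obj M) := by
  haveI := preservesZeroMorphisms_stalkFunctor (X := X) x
  exact (stalkFunctor x).map_isZero hM

/-- **An `𝒪_X`-module all of whose stalks vanish is zero** (every section has zero germs, hence vanishes locally,
hence vanishes: Mathlib's stalkwise zero criterion for abelian sheaves, reflected along the faithful forgetful
functor). [cite: Hartshorne1977, II Ex. 1.2 (p. 66)] -/
theorem isZero_of_forall_isZero_stalk (M : X.Modules) (h : ∀ x : X, IsZero ((stalkFunctor x).obj M)) : IsZero M := by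
  -- the underlying abelian sheaf is zero (its stalks are the same abelian groups)
  have hZ : IsZero ((modulesToSheaf X).obj M) := by
    refine (TopCat.Sheaf.isZero_iff_stalkFunctor_obj_isZero _).mpr fun x => ?_
    have hs : Subsingleton ((stalkFunctor x).obj M) := ModuleCat.isZero_iff_subsingleton.mp (h x)
    exact @AddCommGrpCat.isZero_of_subsingleton _ hs
  -- reflect along the faithful forgetful functor
  rw [IsZero.iff_id_eq_zero]
  apply (modulesToSheaf X).map_injective
  exact hZ.eq_of_src _ _

/-- **An `𝒪_X`-module is zero iff all its stalks are.** [cite: Hartshorne1977, II Ex. 1.2 (p. 66)] -/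
theorem isZero_iff_forall_isZero_stalk (M : X.Modules) : IsZero M ↔ ∀ x : X, IsZero ((stalkFunctor x).obj M) :=
  ⟨fun hM x => isZero_stalk_of_isZero hM x, isZero_of_forall_isZero_stalk M⟩

/-! ## Exactness -/

/-- **A short complex of `𝒪_X`-modules with exact stalk complexes is exact** (a section killed by `g` has, at each
point, a germ in the image of `f_x`, hence is locally in the image of `f`: the tree's local exactness test
`Modules/LocalExactness.exact_of_locally_exact`). [cite: Hartshorne1977, II Ex. 1.2 (c) (p. 66)] -/
theorem exact_of_forall_stalk_exact (S : ShortComplex X.Modules)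
    (h : ∀ x : X, ∀ v : (stalkFunctor x).obj S.X₂, (stalkFunctor x).map S.g v = 0 →
      ∃ w : (stalkFunctor x).obj S.X₁, (stalkFunctor x).map S.f w = v) : S.Exact := by
  refine exact_of_locally_exact S fun V s hs x hxV => ?_
  -- the germ of `s` is killed by `g_x`, hence is `f_x (germ t)` for a section `t` near `x`
  have hg : (stalkFunctor x).map S.g (stalkGerm x S.X₂ V hxV s) = 0 := by
    rw [stalkFunctor_map_germ, hs, stalkGerm_zero]
  obtain ⟨w, hw⟩ := h x _ hg
  obtain ⟨U, hxU, t, rfl⟩ := exists_stalkGerm_eq x S.X₁ w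
  rw [stalkFunctor_map_germ] at hw
  -- `f t` and `s` have the same germ at `x`, so agree on some `W ⊆ U ⊓ V`
  obtain ⟨W, hxW, iU, iV, hW⟩ := TopCat.Presheaf.germ_eq S.X₂.presheaf x hxU hxV _ _ hw
  refine ⟨W, iV, hxW, S.X₁.presheaf.map iU.op t, ?_⟩
  rw [Scheme.Modules.Hom.app_map_apply, hW]

/-- **Exactness of a short complex of `𝒪_X`-modules is detected on stalks.** (⇒: the forgetful functor to abelian
sheaves is exact and exactness of abelian sheaves is stalkwise, Mathlib; ⇐: `exact_of_forall_stalk_exact`.)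
[cite: Hartshorne1977, II Ex. 1.2 (c) (p. 66)] -/
theorem exact_iff_forall_stalk_exact (S : ShortComplex X.Modules) :
    S.Exact ↔ ∀ x : X, ∀ v : (stalkFunctor x).obj S.X₂, (stalkFunctor x).map S.g v = 0 →
      ∃ w : (stalkFunctor x).obj S.X₁, (stalkFunctor x).map S.f w = v := by
  refine ⟨fun hS x v hv => ?_, exact_of_forall_stalk_exact S⟩
  -- exactness of the underlying abelian sheaves, then of their stalks (Mathlib)
  have h₁ : (S.map (modulesToSheaf X)).Exact := hS.map (modulesToSheaf X)
  have h₂ := (TopCat.Sheaf.exact_iff_stalkFunctor_map_exact (S.map (modulesToSheaf X))).mp h₁ x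
  rw [ShortComplex.ab_exact_iff] at h₂
  obtain ⟨w, hw⟩ := h₂ v hv
  exact ⟨w, hw⟩

end Literature.AlgebraicGeometry.Modules

end
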